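import Mathlib
import Summits.NavierStokesRegularity.NavierStokesRegularity.Theorems.FilamentSkeletonRssSkeletonJ1RLiaLipschitzToolsDeriv

/-!
# Crux `SkeletonJ1R` (stmt-NavierStokesRegularity-23610) · line `streamline_kantorovich_R` · toward stub F2-d (`LiaDefectDerivBL`, v7), brick of S4′b for B1′:
# THE TWO-POINT (LIPSCHITZ) BOUND FOR THE THIRD-DERIVATIVE FORM `Z = (b a₁)•T×W + (b a₀)•(T×W₁ + K×W)` from bounds on its factors

Hand `leafhand-ns-filamentskeletonrs-1` (gen 0), `--supports stmt-NavierStokesRegularity-23610 --as helper`.  MODEL rung, NEGATIVE side of the ladder: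
algebra for a HYPOTHETICAL filament-type blow-up skeleton; nothing here is a claim about Navier–Stokes regularity; the stub and the crux stay OPEN.

`x‴` of the LIA reference has the form `Z = (b·a₁)•T×W + (b·a₀)•(T×W₁ + K×W)` (`…LiaThirdDerivative.IsLiaReference.hasDerivAt_deriv_deriv_global`:
`b = β⁻¹`, `a₁ = (φ∘x)′`, `a₀ = φ∘x`, `T = x′`, `K = x″`, `W = W∘x`, `W₁ = DW·x′`).  `norm_thirdDerivForm_sub_le`: if at two parameters `p, q` the factors obey
`|a₁q| ≤ A₁`, `|a₁p − a₁q| ≤ Λ·δ`, `|a₀q| ≤ 1`, `|a₀p − a₀q| ≤ A₁·δ`, `‖T‖ ≤ 1`, `‖Tp − Tq‖ ≤ κδ`, `‖K‖ ≤ κ`, `‖Kp − Kq‖ ≤ Hδ`, `‖Wp‖ ≤ M`, `‖Wp − Wq‖ ≤ Lδ`,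
`‖W₁p‖ ≤ L`, `‖W₁p − W₁q‖ ≤ L₂δ` (only the bounds the telescoping uses), then
`‖Z p − Z q‖ ≤ |b|·(Λ·M + 2A₁(κM + L) + (2κL + L₂ + H·M))·δ` — the Lipschitz constant `H′` of the window input of
`…LiaSelfDerivEstimate.symmDerivStrand_sub_lia_le`, once the factor bounds are supplied (`…LiaThirdDerivative`, `…LiaAmbientFDerivBound`,
`…LiaAmbientPathSecondDeriv`, `…LiaLipschitzToolsDeriv`).
-/

set_option linter.dupNamespace false -- `NavierStokesRegularity.NavierStokesRegularity` path/namespace repetition is the tree convention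

noncomputable section

namespace Summit.NavierStokesRegularity.NavierStokesRegularity.Theorems.SkeletonJ1RFrame

open Set Function Filter MeasureTheory Real Topology
open Literature.Analysis.FluidPDE
open scoped InnerProductSpace BigOperators

/-- **Two-point bound for the third-derivative form** (module docstring). [folklore] -/
theorem norm_thirdDerivForm_sub_le {b A₁ Λ κ H M L L₂ δ : ℝ} (hA₁ : 0 ≤ A₁) (hΛ : 0 ≤ Λ) (hκ : 0 ≤ κ) (hH : 0 ≤ H) (hM : 0 ≤ M) (hL : 0 ≤ L)
    (hδ : 0 ≤ δ) {a₁p a₁q a₀p a₀q : ℝ} {Tp Tq Kp Kq Wp Wq W1p W1q : EuclideanSpace ℝ (Fin 3)}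
    (ha₁q : |a₁q| ≤ A₁) (ha₁d : |a₁p - a₁q| ≤ Λ * δ) (ha₀q : |a₀q| ≤ 1) (ha₀d : |a₀p - a₀q| ≤ A₁ * δ)
    (hTp : ‖Tp‖ ≤ 1) (hTq : ‖Tq‖ ≤ 1) (hTd : ‖Tp - Tq‖ ≤ κ * δ) (hKp : ‖Kp‖ ≤ κ) (hKq : ‖Kq‖ ≤ κ) (hKd : ‖Kp - Kq‖ ≤ H * δ)
    (hWp : ‖Wp‖ ≤ M) (hWd : ‖Wp - Wq‖ ≤ L * δ) (hW1p : ‖W1p‖ ≤ L) (hW1d : ‖W1p - W1q‖ ≤ L₂ * δ) :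
    ‖((b * a₁p) • cross Tp Wp + (b * a₀p) • (cross Tp W1p + cross Kp Wp)) -
        ((b * a₁q) • cross Tq Wq + (b * a₀q) • (cross Tq W1q + cross Kq Wq))‖ ≤
      |b| * (Λ * M + 2 * A₁ * (κ * M + L) + (2 * κ * L + L₂ + H * M)) * δ := by
  have hb := abs_nonneg b
  -- term 1: (b a₁) • T×W
  have t1 : ‖(b * a₁p) • cross Tp Wp - (b * a₁q) • cross Tq Wq‖ ≤ |b| * (Λ * M + A₁ * (κ * M + L)) * δ := by
    have h := norm_smul_cross_sub_le (b * a₁p) (b * a₁q) Tp Tq Wp Wq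
    have e1 : |b * a₁p - b * a₁q| = |b| * |a₁p - a₁q| := by rw [← mul_sub, abs_mul]
    have e2 : |b * a₁q| = |b| * |a₁q| := abs_mul _ _
    rw [e1, e2] at h
    refine h.trans ?_
    have i1 : |b| * |a₁p - a₁q| * (‖Tp‖ * ‖Wp‖) ≤ |b| * (Λ * δ) * (1 * M) := by gcongr
    have i2 : |b| * |a₁q| * (‖Tp - Tq‖ * ‖Wp‖ + ‖Tq‖ * ‖Wp - Wq‖) ≤ |b| * A₁ * ((κ * δ) * M + 1 * (L * δ)) := by gcongr
    calc _ ≤ |b| * (Λ * δ) * (1 * M) + |b| * A₁ * ((κ * δ) * M + 1 * (L * δ)) := add_le_add i1 i2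
      _ = |b| * (Λ * M + A₁ * (κ * M + L)) * δ := by ring
  -- term 2: (b a₀) • (T×W₁ + K×W)
  have hUp : ‖cross Tp W1p + cross Kp Wp‖ ≤ L + κ * M := by
    refine (norm_add_le _ _).trans (add_le_add ?_ ?_)
    · exact (norm_cross_le_norm_mul_norm _ _).trans (by nlinarith [norm_nonneg Tp, norm_nonneg W1p, mul_le_mul hTp hW1p (norm_nonneg _) zero_le_one])
    · exact (norm_cross_le_norm_mul_norm _ _).trans (mul_le_mul hKp hWp (norm_nonneg _) hκ)
  have hUd : ‖(cross Tp W1p + cross Kp Wp) - (cross Tq W1q + cross Kq Wq)‖ ≤ (κ * L + L₂ + H * M + κ * L) * δ := by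
    have hs : (cross Tp W1p + cross Kp Wp) - (cross Tq W1q + cross Kq Wq) =
        ((1:ℝ) • cross Tp W1p - (1:ℝ) • cross Tq W1q) + ((1:ℝ) • cross Kp Wp - (1:ℝ) • cross Kq Wq) := by
      simp only [one_smul]; abel
    rw [hs]
    have h1 := norm_smul_cross_sub_le 1 1 Tp Tq W1p W1q
    have h2 := norm_smul_cross_sub_le 1 1 Kp Kq Wp Wq
    rw [sub_self, abs_zero, zero_mul, zero_add, abs_one, one_mul] at h1 h2
    refine (norm_add_le _ _).trans ((add_le_add h1 h2).trans ?_)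
    have i1 : ‖Tp - Tq‖ * ‖W1p‖ + ‖Tq‖ * ‖W1p - W1q‖ ≤ (κ * δ) * L + 1 * (L₂ * δ) := by gcongr
    have i2 : ‖Kp - Kq‖ * ‖Wp‖ + ‖Kq‖ * ‖Wp - Wq‖ ≤ (H * δ) * M + κ * (L * δ) := by gcongr
    calc _ ≤ (κ * δ) * L + 1 * (L₂ * δ) + ((H * δ) * M + κ * (L * δ)) := add_le_add i1 i2
      _ = (κ * L + L₂ + H * M + κ * L) * δ := by ring
  have t2 : ‖(b * a₀p) • (cross Tp W1p + cross Kp Wp) - (b * a₀q) • (cross Tq W1q + cross Kq Wq)‖ ≤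
      |b| * (A₁ * (L + κ * M) + (κ * L + L₂ + H * M + κ * L)) * δ := by
    have h := norm_smul_sub_smul_le (b * a₀p) (b * a₀q) (cross Tp W1p + cross Kp Wp) (cross Tq W1q + cross Kq Wq)
    have e1 : |b * a₀p - b * a₀q| = |b| * |a₀p - a₀q| := by rw [← mul_sub, abs_mul]
    have e2 : |b * a₀q| = |b| * |a₀q| := abs_mul _ _
    rw [e1, e2] at h
    refine h.trans ?_
    have hU0 : 0 ≤ L + κ * M := by positivity
    have i1 : |b| * |a₀p - a₀q| * ‖cross Tp W1p + cross Kp Wp‖ ≤ |b| * (A₁ * δ) * (L + κ * M) := by gcongr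
    have i2 : |b| * |a₀q| * ‖(cross Tp W1p + cross Kp Wp) - (cross Tq W1q + cross Kq Wq)‖ ≤
        |b| * 1 * ((κ * L + L₂ + H * M + κ * L) * δ) := by gcongr
    calc _ ≤ |b| * (A₁ * δ) * (L + κ * M) + |b| * 1 * ((κ * L + L₂ + H * M + κ * L) * δ) := add_le_add i1 i2
      _ = |b| * (A₁ * (L + κ * M) + (κ * L + L₂ + H * M + κ * L)) * δ := by ring
  -- assemble
  have hs : ((b * a₁p) • cross Tp Wp + (b * a₀p) • (cross Tp W1p + cross Kp Wp)) -
        ((b * a₁q) • cross Tq Wq + (b * a₀q) • (cross Tq W1q + cross Kq Wq)) =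
      ((b * a₁p) • cross Tp Wp - (b * a₁q) • cross Tq Wq) +
        ((b * a₀p) • (cross Tp W1p + cross Kp Wp) - (b * a₀q) • (cross Tq W1q + cross Kq Wq)) := by abel
  rw [hs]
  calc _ ≤ ‖(b * a₁p) • cross Tp Wp - (b * a₁q) • cross Tq Wq‖ +
        ‖(b * a₀p) • (cross Tp W1p + cross Kp Wp) - (b * a₀q) • (cross Tq W1q + cross Kq Wq)‖ := norm_add_le _ _
    _ ≤ |b| * (Λ * M + A₁ * (κ * M + L)) * δ + |b| * (A₁ * (L + κ * M) + (κ * L + L₂ + H * M + κ * L)) * δ := add_le_add t1 t2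
    _ = |b| * (Λ * M + 2 * A₁ * (κ * M + L) + (2 * κ * L + L₂ + H * M)) * δ := by ring

end Summit.NavierStokesRegularity.NavierStokesRegularity.Theorems.SkeletonJ1RFrame

end
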